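import Literature.NumberTheory.Automorphic.UnitaryGroupTruncatedKernelIntegrableOfSiegel
import Literature.NumberTheory.Automorphic.UnitaryGroupSiegelConjLevelDepth
import HarnessLib

/-!
# `TruncatedKernelIntegrable` HOLDS for the quasi-split unitary group `U(J₃)` of a CM extension `L/L⁺`

(Rogawski, *Automorphic Representations of Unitary Groups in Three Variables* (1990), §2.2 p. 13: «For
`T` sufficiently regular, `k^T(x)` is integrable over `𝐙G\𝐆`»; Arthur, *A trace formula for reductive groups
I*, Duke Math. J. 45 (1978), Thm. 7.1 and §8; Shokranian (1992), Thm. (3.17).)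

Topic `NumberTheory/Automorphic`; namespace `Literature.NumberTheory.Automorphic.UnitaryGroup`. THEOREMS ONLY
(no definition, no named fact, no instance, no notation, no `sorry`). THE DISCHARGE of the named fact ★
`UnitaryGroup.TruncatedKernelIntegrable` (`UnitaryGroupArthurTruncatedTrace`) — T1-qs law 1 of the line
`Cruxes/H413/Lines/F0_T1InnerFormTraceIdentity.lean` (cell `pub/hodgecm-mathlib`, crux H413) — at the CM pair
`(L⁺, L, complexConj)` and, generically, for a quadratic `E/F` with `c² = 1`, `c ≠ 1` (unimodularity and the
adelic Iwasawa decomposition as hypotheses): ★ `truncatedKernelIntegrable_cm_of_levelDepth` ∕ ★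
`truncatedKernelIntegrable_of_levelDepth` (`UnitaryGroupTruncatedKernelIntegrableOfSiegel`: Siegel set, GLUE (ρ),
thin-set integration over the ray, three-factor normal form) fed with the LEVEL DEPTH of the dilated fundamental
domains on the Siegel set, ★ `exists_rational_borel_forall_valuation_conj_le`
(`UnitaryGroupSiegelConjLevelDepth`).

* `truncatedKernelIntegrable_of_unimodular_iwasawa` — generic quadratic `E/F`;
* **`truncatedKernelIntegrable_cm`** — `TruncatedKernelIntegrable L⁺ L (complexConj L)`, no hypothesis.

## References
* J. D. Rogawski, *Automorphic Representations of Unitary Groups in Three Variables*, Ann. of Math. Stud.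
  123 (1990), §2.2 (p. 13) [Rogawski1990].
* J. Arthur, *A trace formula for reductive groups I*, Duke Math. J. 45 (1978), Thm. 7.1, §8 (pp. 947–950)
  [Arthur1978TraceFormulaI].
* S. Shokranian, *The Selberg–Arthur Trace Formula*, LNM 1503 (1992), Thm. (3.17) [Shokranian1992].
-/

set_option autoImplicit false

noncomputable section

open MeasureTheory Measure NumberField NumberField.mixedEmbedding IsDedekindDomain Set
open scoped NNReal ENNReal Pointwise MatrixGroups Classical

namespace Literature.NumberTheory.Automorphic

namespace UnitaryGroup

variable {F E : Type} [Field F] [NumberField F] [Field E] [NumberField E] [Algebra F E]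
  {c : E ≃ₐ[F] E}

/-- **`TruncatedKernelIntegrable F E c` for a quadratic `E/F`** (`c² = 1`, `c ≠ 1`, `[E:F] = 2`), given
unimodularity of `U(J₃)(𝔸_F)` and the adelic Iwasawa decomposition `G(𝔸_F) = B(𝔸_F) · K_U`: ★
`truncatedKernelIntegrable_of_levelDepth` with the level depth ★ `exists_rational_borel_forall_valuation_conj_le`.
[cite: Rogawski1990, §2.2 (p. 13)] [cite: Arthur1978TraceFormulaI, Thm. 7.1] -/
theorem truncatedKernelIntegrable_of_unimodular_iwasawa (hc : c * c = 1) (hc1 : c ≠ 1)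
    (h2 : Module.finrank F E = 2)
    (hunimod : ∀ [MeasurableSpace (quasiSplit F E c 3).Adelic] [BorelSpace (quasiSplit F E c 3).Adelic]
      (νG : Measure (quasiSplit F E c 3).Adelic), νG.IsHaarMeasure → νG.IsMulRightInvariant)
    (hBK : ∀ g : (quasiSplit F E c 3).Adelic, ∃ b ∈ borelAdelic F E c 3, ∃ k : (quasiSplit F E c 3).Adelic,
      adelicVal F E c 3 ((StdForm.antidiagonal 3).over E) k ∈ standardMaximalCompactGL 3 E ∧ g = b * k) :
    TruncatedKernelIntegrable F E c :=
  truncatedKernelIntegrable_of_levelDepth hc hc1 h2 hunimod hBK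
    (fun hΩ _ hW hSTt hexp _ h𝔫 => exists_rational_borel_forall_valuation_conj_le hc hΩ hW hSTt hexp h𝔫)

/-- **`TruncatedKernelIntegrable` HOLDS at the CM pair `(L⁺, L, complexConj)`** — Rogawski's «for `T`
sufficiently regular, `k^T(x)` is integrable over `G(F)\G(𝔸_F)`» for the quasi-split `U(J₃)` attached to a CM
field `L`: for every Haar measure `ν` of `N(𝔸)`, every fundamental domain `𝓕` of `N(F)`, every automorphic measure
`μ` and every test function `f` there is `T₀` with `[g] ↦ k^T(g⁻¹)` `μ`-integrable for all `T > T₀`. ★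
`truncatedKernelIntegrable_cm_of_levelDepth` with the level depth ★ `exists_rational_borel_forall_valuation_conj_le`.
[cite: Rogawski1990, §2.2 (p. 13)] [cite: Arthur1978TraceFormulaI, Thm. 7.1] [cite: Shokranian1992, Thm. (3.17)] -/
theorem truncatedKernelIntegrable_cm (L : Type) [Field L] [NumberField L] [IsCMField L] :
    TruncatedKernelIntegrable (↥(maximalRealSubfield L)) L (IsCMField.complexConj L) :=
  truncatedKernelIntegrable_cm_of_levelDepth L
    (fun hΩ _ hW hSTt hexp _ h𝔫 =>
      exists_rational_borel_forall_valuation_conj_le (complexConj_mul_complexConj L) hΩ hW hSTt hexp h𝔫)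

end UnitaryGroup

end Literature.NumberTheory.Automorphic
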